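import Mathlib
import Literature.NumberTheory.Transcendental.SemialgebraicMapsProofs
import Literature.NumberTheory.Transcendental.SemialgebraicMapsSmoothProofs
import Literature.NumberTheory.Transcendental.SemialgebraicVolume
import Literature.ModelTheory.ExponentialFields.SemialgebraicInterior
import Literature.NumberTheory.Transcendental.KZCalculus
import Literature.NumberTheory.Transcendental.KZLogCalculusProofs
import Summits.KontsevichZagierPeriods.KontsevichZagierPeriods.Theorems.SymplecticScissorsPlanarSAZylevStubMosaic

/-!
# Crux `SymplecticScissors.PlanarSAZylev` (stmt-KontsevichZagierPeriods-9848), line `reservoir-peeling`: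
realisation of rule-2 generators and the class of a region

* `assembly_realise` — a change-of-variables datum of the Kontsevich–Zagier calculus between two
  planar domains whose Jacobian has absolute value `1` on the source (a `ℚ`-semialgebraic map with a
  within-derivative at every point of the source, injective) is an instance of the pinned
  pseudogroup equivalence `E`: shrink the source to the open co-null set where the map is `C¹`
  (generic smoothness of semialgebraic functions, `IsSemialgebraicFunOn.exists_contDiffOn_holds`,
  Bochnak–Coste–Roy 1998 §2.9; interiors and frontiers of `ℚ`-semialgebraic sets) and discard the
  null image of the discarded null set.
* `assembly_unitSet` lemmas — the *unit set* `ρ.domain ∩ {integrand = 1}` of a planar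
  representation is `ℚ`-semialgebraic of finite area, equals the domain when the integrand is `1`,
  and is additive along domain-additivity data.
* `assembly_cls_congr`, `assembly_cls_union` — for a class map `cls` from finite-area `ℚ`-regions to
  an additive monoid presented by `mk` on bounded regions (pinned as in `assembly_planarCancel`)
  with `cls S = mk K` for some bounded model `K ~ S`: `E`-equivalent regions have the same class and
  a.e.-disjoint unions add.

No definitions. [folklore]
-/

noncomputable section

open MeasureTheory Set
open Literature.NumberTheory.Transcendental Literature.ModelTheory.ExponentialFields

namespace Summit.KontsevichZagierPeriods.SymplecticScissors.PlanarSAZylev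

/-! ### Generic smoothness: rule-2 data are instances of `E` -/

/-- **Realisation of a rule-2 datum.** If `Φ` is `ℚ`-semialgebraic on a `ℚ`-semialgebraic planar
`σ`, has a within-derivative `Φ' x` at every `x ∈ σ`, is injective on `σ`, and `|det Φ' x| = 1` on
`σ`, then `E σ (Φ '' σ)` for the pinned pseudogroup equivalence `E`. [folklore] -/
theorem assembly_realise (E : Set (Fin 2 → ℝ) → Set (Fin 2 → ℝ) → Prop)
    (HE : ∀ A B : Set (Fin 2 → ℝ), E A B ↔
        ∃ (U : Set (Fin 2 → ℝ)) (Φ : (Fin 2 → ℝ) → (Fin 2 → ℝ)),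
          U ⊆ A ∧ IsSemialgebraic ℚ U ∧ IsOpen U ∧ volume (A \ U) = 0 ∧
          IsSemialgebraicMapOn ℚ U Φ ∧ ContDiffOn ℝ 1 Φ U ∧ InjOn Φ U ∧
          (∀ p ∈ U, |(fderiv ℝ Φ p).det| = 1) ∧ Φ '' U ⊆ B ∧ volume (B \ Φ '' U) = 0)
    {σ : Set (Fin 2 → ℝ)} (hσ : IsSemialgebraic ℚ σ) {Φ : (Fin 2 → ℝ) → (Fin 2 → ℝ)}
    {Φ' : (Fin 2 → ℝ) → (Fin 2 → ℝ) →L[ℝ] (Fin 2 → ℝ)} (hΦsa : IsSemialgebraicMapOn ℚ σ Φ)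
    (hΦ' : ∀ x ∈ σ, HasFDerivWithinAt Φ (Φ' x) σ x) (hinj : InjOn Φ σ)
    (hdet : ∀ x ∈ σ, |(Φ' x).det| = 1) : E σ (Φ '' σ) := by
  -- the coordinates of `Φ` are semialgebraic functions on `σ`, smooth on open co-null parts
  have hcoord : ∀ j, IsSemialgebraicFunOn ℚ σ fun x => Φ x j :=
    (isSemialgebraicMapOn_iff_forall_holds hσ).1 hΦsa
  obtain ⟨G₀, hG₀σ, hG₀o, hG₀sa, hG₀smooth, -, hG₀null⟩ := KZ.exists_isOpen_contDiffOn hσ (hcoord 0)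
  obtain ⟨G₁, hG₁σ, hG₁o, hG₁sa, hG₁smooth, -, hG₁null⟩ := KZ.exists_isOpen_contDiffOn hσ (hcoord 1)
  set U : Set (Fin 2 → ℝ) := G₀ ∩ G₁ with hU
  have hUσ : U ⊆ σ := fun x hx => hG₀σ hx.1
  have hUo : IsOpen U := hG₀o.inter hG₁o
  have hUsa : IsSemialgebraic ℚ U := hG₀sa.inter hG₁sa
  have hσU : volume (σ \ U) = 0 := by
    refine measure_mono_null (fun x hx => ?_) (measure_union_null hG₀null hG₁null)
    by_cases h0 : x ∈ G₀
    · exact Or.inr ⟨hx.1, fun h1 => hx.2 ⟨h0, h1⟩⟩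
    · exact Or.inl ⟨hx.1, h0⟩
  have hC1 : ContDiffOn ℝ 1 Φ U := by
    rw [contDiffOn_pi]
    intro j
    fin_cases j
    · exact (hG₀smooth.of_le (by exact_mod_cast le_top)).mono inter_subset_left
    · exact (hG₁smooth.of_le (by exact_mod_cast le_top)).mono inter_subset_right
  have hfd : ∀ p ∈ U, fderiv ℝ Φ p = Φ' p := fun p hp =>
    ((hΦ' p (hUσ hp)).hasFDerivAt (Filter.mem_of_superset (hUo.mem_nhds hp) hUσ)).fderiv
  refine (HE _ _).2 ⟨U, Φ, hUσ, hUsa, hUo, hσU, hΦsa.mono hUσ hUsa, hC1, hinj.mono hUσ,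
    fun p hp => by rw [hfd p hp]; exact hdet p (hUσ hp), image_mono hUσ, ?_⟩
  -- the missed part of the image is the image of the null set `σ \ U`
  have hdiff : DifferentiableOn ℝ Φ (σ \ U) := fun x hx =>
    (hΦ' x hx.1).differentiableWithinAt.mono sdiff_subset
  refine measure_mono_null ?_ (addHaar_image_eq_zero_of_differentiableOn_of_addHaar_eq_zero
    volume hdiff hσU)
  rintro _ ⟨⟨x, hx, rfl⟩, hy⟩
  exact ⟨x, ⟨hx, fun hxU => hy ⟨x, hxU, rfl⟩⟩, rfl⟩

/-! ### The unit set of a planar representation -/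

/-- The *unit set* `{x ∈ σ | f x = 1}` of a planar representation `(σ, f)` is `ℚ`-semialgebraic:
it is the preimage of the graph of `f` under the polynomial map `x ↦ (x, 1)`. [folklore] -/
theorem assembly_isSemialgebraic_unitSet (ρ : KZ.IntegralRep 2) :
    IsSemialgebraic ℚ (ρ.domain ∩ {x | ρ.integrand x = 1}) := by
  have hg : IsSemialgebraic ℚ {z : Fin (2 + 1) → ℝ | Fin.init z ∈ ρ.domain ∧
      z (Fin.last 2) = ρ.integrand (Fin.init z)} :=
    isSemialgebraicFunOn_iff.1 ρ.isSemialgebraicFunOn_integrand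
  let P : Fin (2 + 1) → MvPolynomial (Fin 2) ℚ := Fin.snoc (fun i => MvPolynomial.X i) 1
  have hinit : ∀ x : Fin 2 → ℝ, Fin.init (fun j => MvPolynomial.aeval x (P j)) = x := by
    intro x
    funext i
    show MvPolynomial.aeval x (P (Fin.castSucc i)) = x i
    simp [P]
  have hP2 : P (Fin.last 2) = 1 := Fin.snoc_last _ _
  have hlast : ∀ x : Fin 2 → ℝ, MvPolynomial.aeval x (P (Fin.last 2)) = 1 := by
    intro x
    rw [hP2, map_one]
  convert hg.preimage_aeval P using 1
  ext x
  constructor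
  · rintro ⟨hx, h1⟩
    refine ⟨?_, ?_⟩
    · show Fin.init (fun j => MvPolynomial.aeval x (P j)) ∈ ρ.domain
      rw [hinit]; exact hx
    · show MvPolynomial.aeval x (P (Fin.last 2)) =
        ρ.integrand (Fin.init (fun j => MvPolynomial.aeval x (P j)))
      rw [hinit, hlast, h1]
  · rintro ⟨hx, h1⟩
    have hx' : x ∈ ρ.domain := by
      have h : Fin.init (fun j => MvPolynomial.aeval x (P j)) ∈ ρ.domain := hx
      rwa [hinit] at h
    have h1' : MvPolynomial.aeval x (P (Fin.last 2)) =
        ρ.integrand (Fin.init (fun j => MvPolynomial.aeval x (P j))) := h1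
    rw [hinit, hlast] at h1'
    exact ⟨hx', h1'.symm⟩

/-- The unit set of a planar representation has finite area (the integrand, which is `1` there,
is absolutely integrable). [folklore] -/
theorem assembly_volume_unitSet_ne_top (ρ : KZ.IntegralRep 2) :
    volume (ρ.domain ∩ {x | ρ.integrand x = 1}) ≠ ⊤ := by
  have hmeas : MeasurableSet (ρ.domain ∩ {x | ρ.integrand x = 1}) :=
    IsSemialgebraic.measurableSet_holds (assembly_isSemialgebraic_unitSet ρ)
  have hint : IntegrableOn (fun _ => (1 : ℝ)) (ρ.domain ∩ {x | ρ.integrand x = 1}) :=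
    (ρ.integrableOn.mono_set inter_subset_left).congr_fun (fun x hx => hx.2) hmeas
  rw [integrableOn_const_iff] at hint
  rcases hint with h | h
  · simp at h
  · exact h.ne

/-- With integrand `1` on the domain, the unit set is the domain. [folklore] -/
theorem assembly_unitSet_eq (ρ : KZ.IntegralRep 2) (h1 : ∀ x ∈ ρ.domain, ρ.integrand x = 1) :
    ρ.domain ∩ {x | ρ.integrand x = 1} = ρ.domain :=
  inter_eq_left.2 fun x hx => h1 x hx

/-- **Unit sets along domain-additivity data.** If `σ = σ₁ ∪ σ₂` and the integrand of `ρ` agrees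
with those of `ρ₁`, `ρ₂` on their domains, then the unit set of `ρ` is the union of the unit sets
of `ρ₁`, `ρ₂`, and these meet inside `σ₁ ∩ σ₂`. [folklore] -/
theorem assembly_unitSet_union {ρ ρ₁ ρ₂ : KZ.IntegralRep 2}
    (hdom : ρ.domain = ρ₁.domain ∪ ρ₂.domain) (h₁ : EqOn ρ.integrand ρ₁.integrand ρ₁.domain)
    (h₂ : EqOn ρ.integrand ρ₂.integrand ρ₂.domain) :
    ρ.domain ∩ {x | ρ.integrand x = 1} =
      (ρ₁.domain ∩ {x | ρ₁.integrand x = 1}) ∪ (ρ₂.domain ∩ {x | ρ₂.integrand x = 1}) ∧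
    (ρ₁.domain ∩ {x | ρ₁.integrand x = 1}) ∩ (ρ₂.domain ∩ {x | ρ₂.integrand x = 1}) ⊆
      ρ₁.domain ∩ ρ₂.domain := by
  refine ⟨?_, fun x hx => ⟨hx.1.1, hx.2.1⟩⟩
  ext x
  simp only [mem_inter_iff, mem_setOf_eq, mem_union, hdom]
  constructor
  · rintro ⟨hx | hx, h1⟩
    · exact Or.inl ⟨hx, by rw [← h₁ hx, h1]⟩
    · exact Or.inr ⟨hx, by rw [← h₂ hx, h1]⟩
  · rintro (⟨hx, h1⟩ | ⟨hx, h1⟩)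
    · exact ⟨Or.inl hx, by rw [h₁ hx, h1]⟩
    · exact ⟨Or.inr hx, by rw [h₂ hx, h1]⟩

/-! ### The class of a finite-area region in the monoid of bounded regions -/

/-- **`E`-equivalent finite-area regions have the same class.** [folklore] -/
theorem assembly_cls_congr (E : Set (Fin 2 → ℝ) → Set (Fin 2 → ℝ) → Prop)
    (hsymm : ∀ A B : Set (Fin 2 → ℝ), E A B → E B A)
    (htrans : ∀ A B C : Set (Fin 2 → ℝ), E A B → E B C → E A C)
    {M : Type*} [AddCommMonoid M]
    (mk : {A : Set (Fin 2 → ℝ) // IsSemialgebraic ℚ A ∧ Bornology.IsBounded A} → M)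
    (hmk_eq : ∀ A B : {A : Set (Fin 2 → ℝ) // IsSemialgebraic ℚ A ∧ Bornology.IsBounded A},
      mk A = mk B ↔ E A.1 B.1)
    (cls : Set (Fin 2 → ℝ) → M)
    (hcls : ∀ S : Set (Fin 2 → ℝ), IsSemialgebraic ℚ S → volume S ≠ ⊤ →
      ∃ K : {A : Set (Fin 2 → ℝ) // IsSemialgebraic ℚ A ∧ Bornology.IsBounded A},
        E S K.1 ∧ cls S = mk K)
    {S T : Set (Fin 2 → ℝ)} (hS : IsSemialgebraic ℚ S) (hSv : volume S ≠ ⊤)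
    (hT : IsSemialgebraic ℚ T) (hTv : volume T ≠ ⊤) (h : E S T) : cls S = cls T := by
  obtain ⟨K, hK, hcS⟩ := hcls S hS hSv
  obtain ⟨L, hL, hcT⟩ := hcls T hT hTv
  rw [hcS, hcT, hmk_eq]
  exact htrans _ _ _ (htrans _ _ _ (hsymm _ _ hK) h) hL

/-- **A.e.-disjoint unions add.** For finite-area `ℚ`-regions `S`, `T` with `S ∩ T` null,
`cls (S ∪ T) = cls S + cls T`: separate the bounded models by a rational translation and glue.
[folklore] -/
theorem assembly_cls_union (E : Set (Fin 2 → ℝ) → Set (Fin 2 → ℝ) → Prop)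
    (HE : ∀ A B : Set (Fin 2 → ℝ), E A B ↔
        ∃ (U : Set (Fin 2 → ℝ)) (Φ : (Fin 2 → ℝ) → (Fin 2 → ℝ)),
          U ⊆ A ∧ IsSemialgebraic ℚ U ∧ IsOpen U ∧ volume (A \ U) = 0 ∧
          IsSemialgebraicMapOn ℚ U Φ ∧ ContDiffOn ℝ 1 Φ U ∧ InjOn Φ U ∧
          (∀ p ∈ U, |(fderiv ℝ Φ p).det| = 1) ∧ Φ '' U ⊆ B ∧ volume (B \ Φ '' U) = 0)
    (hsymm : ∀ A B : Set (Fin 2 → ℝ), E A B → E B A)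
    (htrans : ∀ A B C : Set (Fin 2 → ℝ), E A B → E B C → E A C)
    (hglue : ∀ A₁ A₂ B₁ B₂ : Set (Fin 2 → ℝ), volume (A₁ ∩ A₂) = 0 → Disjoint B₁ B₂ →
      E A₁ B₁ → E A₂ B₂ → E (A₁ ∪ A₂) (B₁ ∪ B₂))
    {M : Type*} [AddCommMonoid M]
    (mk : {A : Set (Fin 2 → ℝ) // IsSemialgebraic ℚ A ∧ Bornology.IsBounded A} → M)
    (hmk_eq : ∀ A B : {A : Set (Fin 2 → ℝ) // IsSemialgebraic ℚ A ∧ Bornology.IsBounded A},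
      mk A = mk B ↔ E A.1 B.1)
    (hmk_add : ∀ A B : {A : Set (Fin 2 → ℝ) // IsSemialgebraic ℚ A ∧ Bornology.IsBounded A},
      Disjoint A.1 B.1 → mk A + mk B = mk ⟨A.1 ∪ B.1, A.2.1.union B.2.1, A.2.2.union B.2.2⟩)
    (cls : Set (Fin 2 → ℝ) → M)
    (hcls : ∀ S : Set (Fin 2 → ℝ), IsSemialgebraic ℚ S → volume S ≠ ⊤ →
      ∃ K : {A : Set (Fin 2 → ℝ) // IsSemialgebraic ℚ A ∧ Bornology.IsBounded A},
        E S K.1 ∧ cls S = mk K)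
    {S T : Set (Fin 2 → ℝ)} (hS : IsSemialgebraic ℚ S) (hSv : volume S ≠ ⊤)
    (hT : IsSemialgebraic ℚ T) (hTv : volume T ≠ ⊤) (hST : volume (S ∩ T) = 0) :
    cls (S ∪ T) = cls S + cls T := by
  have hSTv : volume (S ∪ T) ≠ ⊤ :=
    ((measure_union_le S T).trans_lt (ENNReal.add_lt_top.2 ⟨hSv.lt_top, hTv.lt_top⟩)).ne
  obtain ⟨K, hK, hcS⟩ := hcls S hS hSv
  obtain ⟨L, hL, hcT⟩ := hcls T hT hTv
  obtain ⟨N, hN, hcST⟩ := hcls (S ∪ T) (hS.union hT) hSTv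
  -- separate `L` from `K`
  obtain ⟨NK, hNK⟩ := mosaic_exists_bound K.2.2
  obtain ⟨NL, hNL⟩ := mosaic_exists_bound L.2.2
  set v : Fin 2 → ℝ := fun i => ((![(NK : ℚ) + NL + 1, 0] : Fin 2 → ℚ) i : ℝ) with hv
  have hvq : ∀ i, v i = ((![(NK : ℚ) + NL + 1, 0] : Fin 2 → ℚ) i : ℝ) := fun i => rfl
  have hL'sa := mosaic_isSemialgebraic_translate L.2.1 v _ hvq
  have hL'b : Bornology.IsBounded ((fun x => x + v) '' L.1) := by
    rw [← Set.add_singleton]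
    exact L.2.2.add Bornology.isBounded_singleton
  have hdisj : Disjoint K.1 ((fun x => x + v) '' L.1) := by
    refine Set.disjoint_left.2 ?_
    rintro x hx ⟨y, hy, rfl⟩
    have h1 := abs_le.1 (hNK _ hx 0)
    have h2 := abs_le.1 (hNL y hy 0)
    have h3 : v 0 = (NK : ℝ) + NL + 1 := by simp [hv]
    have h4 : (y + v) 0 = y 0 + v 0 := rfl
    dsimp only at h1
    linarith [h1.2, h2.1]
  have eL : E L.1 ((fun x => x + v) '' L.1) := mosaic_translate E HE L.2.1 v _ hvq
  have eT : E T ((fun x => x + v) '' L.1) := htrans _ _ _ hL eL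
  have eU : E (S ∪ T) (K.1 ∪ (fun x => x + v) '' L.1) := hglue _ _ _ _ hST hdisj hK eT
  rw [hcS, hcT, hcST, (hmk_eq L ⟨_, hL'sa, hL'b⟩).2 eL, hmk_add K ⟨_, hL'sa, hL'b⟩ hdisj, hmk_eq]
  exact htrans _ _ _ (hsymm _ _ hN) eU

/-- **Realisation of rule-2 data** (stub `stub_realise` of the line, the lead's reshaping of its
assembly stub; = `assembly_realise` as a closed statement). [folklore] -/
theorem stub_realise :
    ∀ (E : Set (Fin 2 → ℝ) → Set (Fin 2 → ℝ) → Prop),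
      (∀ A B : Set (Fin 2 → ℝ), E A B ↔
        ∃ (U : Set (Fin 2 → ℝ)) (Φ : (Fin 2 → ℝ) → (Fin 2 → ℝ)),
          U ⊆ A ∧ IsSemialgebraic ℚ U ∧ IsOpen U ∧ volume (A \ U) = 0 ∧
          IsSemialgebraicMapOn ℚ U Φ ∧ ContDiffOn ℝ 1 Φ U ∧ InjOn Φ U ∧
          (∀ p ∈ U, |(fderiv ℝ Φ p).det| = 1) ∧ Φ '' U ⊆ B ∧ volume (B \ Φ '' U) = 0) →
    ∀ (σ : Set (Fin 2 → ℝ)) (Φ : (Fin 2 → ℝ) → (Fin 2 → ℝ))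
      (Φ' : (Fin 2 → ℝ) → (Fin 2 → ℝ) →L[ℝ] (Fin 2 → ℝ)),
      IsSemialgebraic ℚ σ → IsSemialgebraicMapOn ℚ σ Φ →
      (∀ x ∈ σ, HasFDerivWithinAt Φ (Φ' x) σ x) → InjOn Φ σ →
      (∀ x ∈ σ, |(Φ' x).det| = 1) → E σ (Φ '' σ) := by
  intro E HE σ Φ Φ' hσ hΦsa hΦ' hinj hdet
  exact assembly_realise E HE hσ hΦsa hΦ' hinj hdet

end Summit.KontsevichZagierPeriods.SymplecticScissors.PlanarSAZylev
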